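import Mathlib
import Literature.MathematicalPhysics.QuantumFieldTheory.Balaban1983to89.Beta.FluctuationProjection
import Literature.MathematicalPhysics.QuantumFieldTheory.BalabanImbrieJaffe1984to88.BIJ85Eq7116SurfaceAverage

/-!
# `BalabanImbrieJaffe1984to88.BIJ85Eq219KFoldTorus` — T. Bałaban, J. Imbrie, A. Jaffe, *Renormalization of the Higgs model:
minimizers, propagators and the stability of mean field theory*, Commun. Math. Phys. **97** (1985) 299–329 [BalabanImbrieJaffe1985]:
Sect. 2 pp. 304–305 — **the k-fold identities (2.19) `Q_kQ^{s*}_k = I`, (2.18) `Q^{s*}_kQ^s_k = η^{−1}P^s_k`, (2.23) `Q^{e*}_kQ^e_k =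
η^{−2}P^e_k` for the CONCRETE configuration-space operators on the tori** — `Q_k` = [6I] (1.18) (pub-balaban `B5Block118.QvOp`, straight
contours), `Q^s_k`, `Q^{s*}_k` = `BIJ85Eq7116SurfaceAverage.surfAvgC/surfAdjC`, `Q^e_k`, `Q^{e*}_k` = `BIJ85Eq7111EdgeAverage.edgeAvgC` /
`BIJ85Eq7111EdgeAdjoint.edgeAdjC` — PROVED, with the block-crossing geometry of a straight contour (each of the `n` bonds of
`[x, x+e_μ]` crosses the block face exactly once) — file 17 of the (7.1.2) cluster; the k-fold form is the one used at (4.3.2) p. 311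
(*"we use ∂Q^{s*}_k = Q^{e*}_k∂, and we also use (2.19)"*)

statement-level skeleton of published theorems with citation tags; proofs where landed; nothing here is a claim about
the Yang–Mills mass gap

PDF held: `paper:balaban1985-cmp97-bij-higgs-minimizers` (journal page = PDF page + 298).  Text read as images: PDF pp. 6–7 (journal
304–305; `run/shared/lean/pub/lit-balaban/lit-balaban-r15/pages/1985-cmp97-bij-higgs-minimizers-p006-x2.png`, `…-p007-x2.png`), PDF
p. 13 (journal 311).

CITATION HEADER (lean-in-tree rule).  Part of the lit-balaban TYPED SKELETON (HOME `run/shared/lean/pub/lit-balaban/`); WHAT IS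
REPRODUCED: rows **C1.Eq2.18**, **C1.Eq2.19**, **C1.Eq2.20-2.23** ((2.23)) in their k-fold form (p. 304–305, verbatim: *"Also Q^sQ^{s*} =
LI, Q^{s*}Q^s = LP^s, (2.18) where P^s is the projection onto configurations which are constant on surface bonds and zero on interior
bonds. Furthermore, by (2.13), QQ^{s*} = I. (2.19) … Also Q^eQ^{e*} = L²I, Q^{e*}Q^e = L²P^e, (2.23) where P^e is the orthogonal
projection onto configurations which are constant on edge plaquettes and zero elsewhere. We also need the k-fold averaging operators
Q_k ≡ (Q)^k, etc."*), `HOME/lit-balaban-r15/ROWS-C1.md` (owner r15, referee ref-5; one-step versions on other carriers: r15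
`BIJ85Sect2SurfaceAverages.Qsstar_Qs`, p31 `BIJ85Eq219Proof`, p19 `BIJ85Eq224Proof`).  TYPED READING: as in the siblings; the
k-fold `Q_k` of (2.13)^k is read, as everywhere in the lit-balaban/pub-balaban trees, as [6I] (1.18) `B5Block118.QvOp` (straight
contours `[x, x+e_μ]` of `n` fine bonds, weight `η^{d+1}`); `P^s_k := η·Q^{s*}_kQ^s_k`, `P^e_k := η²·Q^{e*}_kQ^e_k` are DEFINED by the
printed relations and PROVED to be the orthogonal projections with the printed ranges (idempotent, Hermitian, explicit block formula:
face/edge average on surface bonds/edge plaquettes, zero inside).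
WHAT IS KERNEL-CHECKED (zero `sorry`, standard axioms): **`surfAdjC_eq_Jlift`** — the k-fold surface adjoint `Q^{s*}_k` of
(2.16)–(2.17) IS pub-balaban's face-layer lift `J` (`Beta.FluctuationProjection.Jlift`, *"(JB)(x, μ) = n·B(blockOf x, μ) if the μ-digit
of x is n − 1, else 0"*), so that **(2.19)_k `Q_kQ^{s*}_k = 1`** (`QvOp_mul_surfAdjC`, `QvOp_surfAdjC_mulVec`) is pub-balaban's
`QvOp_mul_Jlift` (*"every averaging line of (1.18) meets the face layer exactly once, inside its own block"*, proved there) read in the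
printed vocabulary; **(2.18)_k** `surfProj` with `surfAdj_mul_surfAvg` (`Q^{s*}_kQ^s_k = n·P^s_k`), `surfProj_mulVec` (face average on
surface bonds, `0` on interior bonds), `surfProj_idem`, `surfProj_isHermitian`; **(2.23)_k** `edgeProj` with `edgeAdj_mul_edgeAvg`
(`Q^{e*}_kQ^e_k = n²·P^e_k`), `edgeProj_mulVec`, `edgeProj_idem_apply` (on the orientations `μ ≠ ν`), `edgeProj_isHermitian`.
CONSEQUENCE (not restated): with `surfAdjC = Jlift`, pub-balaban's `FluctuationProjection.Hk`/`Pproj`/`Cov` (the operators `H_k`,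
the fluctuation projection and covariance with `Q_kH_k = 1`, `Hk_unique`) are available on the same carriers for rows C1.Eq2.25ff.
Unit `lit-balaban-p27` (gen 5), HOME as above.
-/

namespace Literature.MathematicalPhysics.QuantumFieldTheory.BalabanImbrieJaffe1984to88.BIJ85Eq219KFoldTorus

open scoped BigOperators Matrix ComplexConjugate
open Finset Complex
open Literature.MathematicalPhysics.QuantumFieldTheory.Balaban1983to89
open Literature.MathematicalPhysics.QuantumFieldTheory.Balaban1983to89.B5Prop11Plancherel
open Literature.MathematicalPhysics.QuantumFieldTheory.Balaban1983to89.B5Prop11Fiber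
open Literature.MathematicalPhysics.QuantumFieldTheory.Balaban1983to89.B5Block118
open Literature.MathematicalPhysics.QuantumFieldTheory.Balaban1983to89.B5Blocks16
open Literature.MathematicalPhysics.QuantumFieldTheory.BalabanImbrieJaffe1984to88.BIJ85Eq7111EdgeAverage
open Literature.MathematicalPhysics.QuantumFieldTheory.BalabanImbrieJaffe1984to88.BIJ85Eq7111EdgeAdjoint
open Literature.MathematicalPhysics.QuantumFieldTheory.BalabanImbrieJaffe1984to88.BIJ85Eq7116SurfaceAverage
open Literature.MathematicalPhysics.QuantumFieldTheory.Balaban1983to89.Beta.FluctuationProjection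
open Literature.MathematicalPhysics.QuantumFieldTheory.Balaban1983to89.Beta.VectorPropagatorDict (ext_of_mulVec')

noncomputable section

variable {d : ℕ} (n : ℕ) [NeZero n] (M : Fin d → ℕ) [hM : ∀ μ, NeZero (M μ)]

/-! ## §1 `Q^{s*}_k` is the face-layer lift `J` of pub-balaban; (2.19)_k `Q_kQ^{s*}_k = I` -/

/-- **`Q^{s*}_k = J`**: the k-fold surface adjoint `η^{−d}(Q^s_k)ᴴ` of (2.16)–(2.17) (`(Q^{s*}_kB)_μ(n·y + j) = n·B_μ(y)` if
`j_μ = n − 1`, else `0`, `surfAdjC_mulVec`) coincides with pub-balaban's face-layer lift `Beta.FluctuationProjection.Jlift`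
(`Jlift_mulVec`, `digitOf_bpt`, `blockOf_bpt`). [cite: BalabanImbrieJaffe1985, (2.16) p.304] -/
theorem surfAdjC_eq_Jlift : surfAdjC n M = Jlift n M := by
  refine ext_of_mulVec' fun B => funext fun b => ?_
  obtain ⟨x, μ⟩ := b
  obtain ⟨⟨y, j⟩, rfl⟩ := (bpt_bijective n M).2 x
  show (surfAdjC n M *ᵥ B) (bpt n M y j, μ) = (Jlift n M *ᵥ B) (bpt n M y j, μ)
  rw [surfAdjC_mulVec, Jlift_mulVec, digitOf_bpt, blockOf_bpt]
  by_cases h : j μ = topIdx n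
  · have h' : ((j μ : ℕ)) = n - 1 := by rw [h]; rfl
    rw [if_pos ((mem_surfOffsets n).mpr h), if_pos h']
  · have h' : ¬((j μ : ℕ) = n - 1) := fun e => h (Fin.ext e)
    rw [if_neg (fun hm => h ((mem_surfOffsets n).mp hm)), if_neg h']

/-- **(2.19) composed k times** (the form used at (4.3.2): *"we also use (2.19)"*): `Q_kQ^{s*}_kB = B` — each straight contour
`[x, x+e_μ]` of [6I] (1.18) contains exactly one surface bond, weight `η^{d+1}·n^d·η^{−1}·… = 1`; this is pub-balaban's
`FluctuationProjection.QvOp_Jlift_mulVec` (*"every averaging line of (1.18) meets the face layer exactly once"*) via `surfAdjC_eq_Jlift`.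
[cite: BalabanImbrieJaffe1985, (2.19) p.305] -/
theorem QvOp_surfAdjC_mulVec (B : Tor M × Fin d → ℂ) : QvOp n M *ᵥ (surfAdjC n M *ᵥ B) = B := by
  rw [surfAdjC_eq_Jlift]
  exact QvOp_Jlift_mulVec n M B

/-- **(2.19), k-fold, as an operator identity**: `Q_kQ^{s*}_k = 1` (pub-balaban `QvOp_mul_Jlift`). [cite: BalabanImbrieJaffe1985, (2.19) p.305] -/
theorem QvOp_mul_surfAdjC : QvOp n M * surfAdjC n M = 1 := by
  rw [surfAdjC_eq_Jlift]
  exact QvOp_mul_Jlift n M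

/-! ## §3 (2.18), k-fold: `Q^{s*}_kQ^s_k = η^{−1}P^s_k`, `P^s_k` the orthogonal projection onto face-constant surface fields -/

/-- `P^s_k := η·Q^{s*}_kQ^s_k` — by (2.18) *"the projection onto configurations which are constant on surface bonds and zero on interior
bonds"* (PROVED below: `surfProj_mulVec`, `surfProj_idem`, `surfProj_isHermitian`). [cite: BalabanImbrieJaffe1985, (2.18) p.304] -/
def surfProj : Matrix (Tor (fine n M) × Fin d) (Tor (fine n M) × Fin d) ℂ :=
  ((n : ℂ))⁻¹ • (surfAdjC n M * surfAvgC n M)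

/-- **(2.18), k-fold**: `Q^{s*}_kQ^s_k = η^{−1}P^s_k = n·P^s_k`. [cite: BalabanImbrieJaffe1985, (2.18) p.304] -/
theorem surfAdj_mul_surfAvg : surfAdjC n M * surfAvgC n M = (n : ℂ) • surfProj n M := by
  have hn : (n : ℂ) ≠ 0 := by exact_mod_cast NeZero.ne n
  rw [surfProj, smul_smul, mul_inv_cancel₀ hn, one_smul]

/-- `P^s_k` pointwise: on a surface bond (`j_μ = n − 1`) the FACE AVERAGE `η^{d−1}Σ_{j′∈B^s_k(μ)}A_μ(n·y + j′)`, on an interior bond `0`.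
[cite: BalabanImbrieJaffe1985, (2.18) p.304] -/
theorem surfProj_mulVec (A : Tor (fine n M) × Fin d → ℂ) (y : Tor M) (j : Fin d → Fin n) (μ : Fin d) :
    (surfProj n M *ᵥ A) (bpt n M y j, μ)
      = if j ∈ surfOffsets n μ then ((n : ℂ) ^ (d - 1))⁻¹ * ∑ j' ∈ surfOffsets n μ, A (bpt n M y j', μ) else 0 := by
  have hn : (n : ℂ) ≠ 0 := by exact_mod_cast NeZero.ne n
  rw [surfProj, Matrix.smul_mulVec, Pi.smul_apply, smul_eq_mul, ← Matrix.mulVec_mulVec, surfAdjC_mulVec, surfAvgC_mulVec]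
  split_ifs
  · rw [← mul_assoc, inv_mul_cancel₀ hn, one_mul]
  · rw [mul_zero]

/-- `P^s_k` is idempotent (`Q^s_kQ^{s*}_k = n`). [cite: BalabanImbrieJaffe1985, (2.18) p.304] -/
theorem surfProj_idem : surfProj n M * surfProj n M = surfProj n M := by
  have hn : (n : ℂ) ≠ 0 := by exact_mod_cast NeZero.ne n
  rw [surfProj, Matrix.smul_mul, Matrix.mul_smul, smul_smul, Matrix.mul_assoc, ← Matrix.mul_assoc (surfAvgC n M),
    surfAvgC_mul_surfAdjC, Matrix.smul_mul, Matrix.one_mul, Matrix.mul_smul, smul_smul, mul_assoc, inv_mul_cancel₀ hn, mul_one]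

/-- `P^s_k` is Hermitian (orthogonal projection). [cite: BalabanImbrieJaffe1985, (2.18) p.304] -/
theorem surfProj_isHermitian : (surfProj n M).IsHermitian := by
  have hc : star (((n : ℂ))⁻¹ * (n : ℂ) ^ d) = ((n : ℂ))⁻¹ * (n : ℂ) ^ d := by
    rw [Complex.star_def, map_mul, map_inv₀, map_pow, Complex.conj_natCast]
  rw [surfProj, surfAdjC, Matrix.smul_mul, smul_smul]
  unfold Matrix.IsHermitian
  rw [Matrix.conjTranspose_smul, hc, Matrix.conjTranspose_mul, Matrix.conjTranspose_conjTranspose]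

/-! ## §4 (2.23), k-fold: `Q^{e*}_kQ^e_k = η^{−2}P^e_k` on the plaquette orientations `μ ≠ ν` -/

/-- `P^e_k := η²·Q^{e*}_kQ^e_k` — by (2.23) *"the orthogonal projection onto configurations which are constant on edge plaquettes and
zero elsewhere"* (PROVED below on every orientation `μ ≠ ν`; the diagonal pairs `(μ,μ)` carry no two-form).
[cite: BalabanImbrieJaffe1985, (2.23) p.305] -/
def edgeProj : Matrix (Tor (fine n M) × (Fin d × Fin d)) (Tor (fine n M) × (Fin d × Fin d)) ℂ :=
  (((n : ℂ)) ^ 2)⁻¹ • (edgeAdjC n M * edgeAvgC n M)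

/-- **(2.23), k-fold**: `Q^{e*}_kQ^e_k = η^{−2}P^e_k = n²·P^e_k`. [cite: BalabanImbrieJaffe1985, (2.23) p.305] -/
theorem edgeAdj_mul_edgeAvg : edgeAdjC n M * edgeAvgC n M = ((n : ℂ) ^ 2) • edgeProj n M := by
  have hn : ((n : ℂ) ^ 2) ≠ 0 := pow_ne_zero _ (by exact_mod_cast NeZero.ne n)
  rw [edgeProj, smul_smul, mul_inv_cancel₀ hn, one_smul]

/-- `P^e_k` pointwise (`2 ≤ d`): on an edge plaquette (`j_μ = j_ν = n − 1`) the EDGE AVERAGE `η^{d−2}Σ_{j′∈B^e_k(μν)}f_{μν}(n·y + j′)`,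
elsewhere `0`. [cite: BalabanImbrieJaffe1985, (2.23) p.305] -/
theorem edgeProj_mulVec (hd : 2 ≤ d) (f : Tor (fine n M) × (Fin d × Fin d) → ℂ) (y : Tor M) (j : Fin d → Fin n) (μ ν : Fin d) :
    (edgeProj n M *ᵥ f) (bpt n M y j, (μ, ν))
      = if j ∈ edgeOffsets n μ ν then ((n : ℂ) ^ (d - 2))⁻¹ * ∑ j' ∈ edgeOffsets n μ ν, f (bpt n M y j', (μ, ν)) else 0 := by
  have hn : ((n : ℂ) ^ 2) ≠ 0 := pow_ne_zero _ (by exact_mod_cast NeZero.ne n)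
  rw [edgeProj, Matrix.smul_mulVec, Pi.smul_apply, smul_eq_mul, ← Matrix.mulVec_mulVec, edgeAdjC_mulVec n M hd, edgeAvgC_mulVec]
  split_ifs
  · rw [← mul_assoc, inv_mul_cancel₀ hn, one_mul]
  · rw [mul_zero]

/-- `P^e_k` is idempotent on every orientation `μ ≠ ν` (pointwise: `P^e_k(P^e_kf) = P^e_kf` there; `2 ≤ d`).
[cite: BalabanImbrieJaffe1985, (2.23) p.305] -/
theorem edgeProj_idem_apply (hd : 2 ≤ d) {μ ν : Fin d} (hμν : μ ≠ ν) (f : Tor (fine n M) × (Fin d × Fin d) → ℂ)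
    (x : Tor (fine n M)) : (edgeProj n M *ᵥ (edgeProj n M *ᵥ f)) (x, (μ, ν)) = (edgeProj n M *ᵥ f) (x, (μ, ν)) := by
  have hn : ((n : ℂ) ^ (d - 2)) ≠ 0 := pow_ne_zero _ (by exact_mod_cast NeZero.ne n)
  obtain ⟨⟨y, j⟩, rfl⟩ := (bpt_bijective n M).2 x
  simp only
  rw [edgeProj_mulVec n M hd, edgeProj_mulVec n M hd]
  split_ifs with hj
  · have h1 : ∀ j' ∈ edgeOffsets n μ ν, (edgeProj n M *ᵥ f) (bpt n M y j', (μ, ν))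
        = ((n : ℂ) ^ (d - 2))⁻¹ * ∑ j'' ∈ edgeOffsets n μ ν, f (bpt n M y j'', (μ, ν)) := by
      intro j' hj'
      rw [edgeProj_mulVec n M hd, if_pos hj']
    rw [Finset.sum_congr rfl h1, Finset.sum_const, card_edgeOffsets n hμν, nsmul_eq_mul]
    push_cast
    rw [← mul_assoc, inv_mul_cancel₀ hn, one_mul]
  · rfl

/-- `P^e_k` is Hermitian. [cite: BalabanImbrieJaffe1985, (2.23) p.305] -/
theorem edgeProj_isHermitian : (edgeProj n M).IsHermitian := by
  have hc : star ((((n : ℂ)) ^ 2)⁻¹ * (n : ℂ) ^ d) = (((n : ℂ)) ^ 2)⁻¹ * (n : ℂ) ^ d := by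
    rw [Complex.star_def, map_mul, map_inv₀, map_pow, map_pow, Complex.conj_natCast]
  rw [edgeProj, edgeAdjC, Matrix.smul_mul, smul_smul]
  unfold Matrix.IsHermitian
  rw [Matrix.conjTranspose_smul, hc, Matrix.conjTranspose_mul, Matrix.conjTranspose_conjTranspose]

end

end Literature.MathematicalPhysics.QuantumFieldTheory.BalabanImbrieJaffe1984to88.BIJ85Eq219KFoldTorus
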